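import Summits.QuantumFields.YangMills.Theorems.BalabanUVNodesN12MinimiserFamilyOfClassDatumLettersUniform
import HarnessLib

/-!
# BalabanUVNodes ∕ N12 — KNIT LINK #2, εreg-UNIFORM DATUM-LETTERS EDITION: THE w1 LINEAGE’s (J0′) CHART THEOREM AT `𝐁_k(Z)` OVER THE LANE’s U3 `N12MinimiserFamilyOfClassDatumLettersUniform`
# — `δ₀` FIRST, then window ∕ datum tolerance ∕ extension ∕ `K` ∕ `𝓐₀` ∕ class tolerance `εr` ∕ datum bond tolerance `ρn` ∕ «T(ρn, εr) ≤ δ₀»; per base field ONLY [15] Thm 1’s rows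
# (E), (T1@q₀) on the unknown minimiser and two DATUM letters on the base field `V_k`
# ([Balaban1985Variational] (2)–(4),(7) p. 278, Thm 1 p. 279, (16)–(18) p. 280, Sect. C (44)–(48) p. 285, (81)–(83) p. 290, (181) p. 307; [Balaban1985RegularSpaces] (1.7), (1.9) p. 77,
# (1.19) p. 79; [Balaban1989LargeFieldI] (1.74) p. 192, Prop. 1 p. 194; [Balaban1989LargeFieldII] p. 357, (1.12)–(1.13) p. 359; [Balaban1988Convergent] (2.2) p. 255, (2.10)–(2.13)
# pp. 256–257, (2.16) p. 257; [Balaban1985Averaging] Prop. 2 (52)–(54) p. 26, (122)–(126) p. 36; [Balaban1987RG1] (0.4) p. 253)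

Cell `pub-ymgap` (HUMAN RULINGS D-0062 ∕ D-0149), seat `pub-ymgap-dag-n12-d` g24 (R134 N12 [B15] s2 = by-name knit at the record; census item E1 = the (J0′) row); count-neutral helper of K1⁹
`stmt-QuantumFields-27364` (`--kind proof --supports … --as helper`).  THEOREMS ONLY (0 `def`, 0 `instance`, 0 `sorry`); two compositions BY NAME + arithmetic, nothing modified.  SIBLING of
`N12MinimiserFamilyAtRecordBjTowerThresholdUniform` (this seat g24, over U2): THIS FILE is the same composition over the lane's U3 `N12MinimiserFamilyOfClassDatumLettersUniform.
hMin_atRecord_of_node00Letters_thm1AtBase_central_ofClass_datumLetters_uniform` (dag-n12-c g26, p725063 = U2 §3 ∘ dag-n12-w3 g4's (σ)_N letter of record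
`N12GaugeLetterLocExplicit.exists_gaugeLetterLoc_atRecord_explicit` at `ν⟨εreg := εr⟩` — the honest shape of `…OfClassDatumLetters` p723781, whose «`∃ δ₀ > 0 ∧ (T ≤ δ₀ → …)`» with `T`
fixed before `δ₀` is junk-closable (the lane's self-report LOCATED-SHAPE-V5; ref-I g36 READ-682 kernel certificate); here `δ₀` is announced BEFORE `εr` and `ρn`, so «`T(ρn, εr) ≤ δ₀`»
is met by taking them small).  The GAUGE row (δ) is no longer a letter: at a (2.12)-class minimiser a residual gauge with (δ) at the tolerance
`T := max ρn (C₁·εr·η₀² + C₂·εr·L²·Σ_{i<k}Lⁱ + m′·ρn)` is PRODUCED from DATUM-side letters and instance-level geometry ∕ numerics.  DISCHARGED here: the forest BEFORE `δ₀` (dag-n12-w3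
`exists_forest_slice_Bj`); UNDER `∀ εr`, the class facts at `ν⟨εreg := εr⟩` (dag-n12-w1 g4 `classLetters_closure_regMSCoPOfRecord_Bj`, from `0 < εr` and [4] Prop. 2's smallness `hα3`∕`hα2`
at `α₀ = 2L²·εr`) AND U3's (σ)_N class numerics `hα3`∕`hα2`∕`haN` at `α₀ = εr·L²` (they follow from the former; eight lines of arithmetic with `ExpMeanLog.deltaSU_pos`).  DISPLAYED
VERBATIM from U3: instance-level the (σ)_N level guard `hkc` ∕ no-wrap `hc` ∕ radii `hMrad` ∕ support `hM₁` numerics, the region geometry `𝒞 N hGN hN1`, the shadow geometry `hGmem`;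
per height `hsbU` at `ρ″ > 0`, `hHB`, `0 ≤ B`; after `δ₀`: window, datum tolerance + budget, extension, `K`, `𝓐₀`, `εr > 0` + floors + `hα3 hα2`, `ρn ≥ 0`, «T ≤ δ₀».  Per base field
EXACTLY: (E) `IsMinimizer` for `U_k({Ω_j(Z)}, εr)`; `PlaqSmallOn (plaqsInside (pts k Z)) δ (ext V_k)`; `∀ c ∈ 𝒞, dist1 ((ext V_k) c) ≤ ρn`; (T1@q₀) over the closure of the class — NO
row on the unknown minimiser except [15] Thm 1's.  Two shapes: U3's own (`∀ {K}, IsCompact K →`) and the CLOSED small-field guard (`∀ G eR`, `K :=` the guard,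
`isCompact_setOf_plaqLeOn`) — the shape `N12MinimiserFamilyKnitRowThresholdUniform` §3 consumes at `G := plaqsInside (pts k (Z ∩ Λᶜ))`.

HONEST FRAMING ∕ LOCATED.  Compositions by name + arithmetic; (E)∕(T1@q₀) are [15] Thm 1's existence ∕ uniqueness rows (NODE 00 ∕ N07 ∕ b11 currencies) — NOT inhabited here; the
datum letters are conditions on the BASE FIELD (its `k`-shadow on `𝒞`; dag-n12-c's LOCATED-GEOM v3: on ring-like `Ω₁(Z)` with large datum holonomy the letter on `𝒞 ⊇` shadows is
itself the obstruction — displayed, not hidden); `δ₀` and `R` are EXISTENCE constants per (instance, height), `δ₀` certified independent of the class ∕ datum ∕ gauge tolerances and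
of `K` (census U4 at the shape level; print's volume-uniform (46)∕(83) and `k`-uniformity NOT claimed); nothing of Bałaban's estimates asserted; N12 NOT discharged; K1⁹ NOT closed;
counts unmoved; one finite 𝕋⁴ programme at fixed `ε = L^{-K}` — R4 closes the conditional rung `BalabanLadder.UV` only; no summit statement is proved here and NOT the Yang–Mills mass
gap (Clay); nothing continuum ∕ ℝ⁴ ∕ OS.
-/

noncomputable section

namespace Summit.QuantumFields.YangMills.BalabanUVNodes.N12MinimiserFamilyAtRecordBjTowerDatumLettersUniform

open scoped BigOperators Matrix.Norms.L2Operator Topology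
open Literature.MathematicalPhysics.QuantumFieldTheory.Balaban1983to89
open T4Continuum
open B15DeterminingSets GaugeField
open ExpMeanLog (expMeanLogSU deltaSU deltaSU_pos)
open T4AdjointCovarianceUnitary (lieSU)
open Node00 hiding blockIter
open B15SU2ChartHolomorphic (genE)
open B15Prop1AnalyticExtClause (cplxVec)
open B15Prop1ChartCalculusSU2 (E3)
open T4CubeChartGnomonic (SU2)
open B14.Eq213DetSet (Bj maxDomT Bj_of_gt)
open B14.Eq213MaximalDomains (side)
open B14.Eq22Determines (IsBlockUnion blockIter)
open B14.Eq216Concrete (feeds)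
open B5Eq118OneStroke (iterBlockOf)
open B15Eq112TorusCover (lift)
open T4AxialGaugeSmallField (boxPlaqs)
open B15Prop1Carrier (plaqsInside)
open Summit.QuantumFields.YangMills.BalabanUVNodes.N12ClassLetterGeometryOfRecord (classLetters_closure_regMSCoPOfRecord_Bj)
open Summit.QuantumFields.YangMills.BalabanUVNodes.N12ForestSlice (exists_forest_slice_Bj)
open Summit.QuantumFields.YangMills.BalabanUVNodes.N12MinimiserFamilyOfClassDatumLettersUniform (hMin_atRecord_of_node00Letters_thm1AtBase_central_ofClass_datumLetters_uniform)
open Literature.MathematicalPhysics.QuantumFieldTheory.BalabanImbrieJaffe1984to88.BIJ85Eq453GaugeField (qsstarGIter0)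
open B15AveragingHolomorphic (iterMh)
open B15SU2ChartHolomorphic (expMulC logCoordC)
open B15ShellGauge193 (shellGauge)
open B15Extension193 (extend)
open B16Sect1Backgrounds (toMS expMul)
open B15Prop1ChartSU2 (su2Chart)
open Metric (ball)
open B15Prop1ClosedGuardUniformRadius (isCompact_setOf_plaqLeOn)

variable {F : T4Family} {k : ℕ}



/-! ## §1  (J0′) `hMin` at `𝐁_k(Z)`: `∃ δ₀ > 0` FIRST, then ∀ window ∕ datum tolerance ∕ extension ∕ `K` ∕ `𝓐₀` ∕ `εr` ∕ `ρn` ∕ «T(ρn, εr) ≤ δ₀»; per base field (E) + the datum's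
plaquette regularity on `Z` + the datum's bondwise flatness on `𝒞` + (T1@q₀) — over U3 -/

/-- ★★★ **(J0′) `hMin` AT THE RECORD's `𝐁_k(Z)` FROM [15] THM 1's ROWS AND DATUM LETTERS ONLY, εreg-UNIFORM, OVER THE LANE's U3** — instance-level inputs: `hkK hk1 hdiv hfloor hZblk`,
the radius letter `hsbU` at `ρ″ > 0`, the right-inverse letter `hHB`, `0 ≤ B`, and VERBATIM from U3 the (σ)_N level guard ∕ no-wrap ∕ radii ∕ support numerics (`hkc hc hMrad hM₁`) and
the region ∕ shadow geometry (`𝒞 N hGN hN1 hGmem`) — the forest is discharged; ANNOUNCED `∃ δ₀ > 0`; THEN for every window `Λ lo hi`, datum tolerance `δ > 0` with its budget, extension,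
compact `K`, `𝓐₀ > 1`, class tolerance `εr > 0` below the floors with [4] Prop. 2's smallness `hα3`∕`hα2` at `2L²·εr` (class facts and U3's own class numerics discharged from these),
datum bond tolerance `ρn ≥ 0`, IF U3's (σ)_N tolerance `T(ρn, εr) ≤ δ₀`, per base field `V_k ∈ K`: (E) the (2.12) minimiser `U₀` for `U_k({Ω_j(Z)}, εr)`,
`PlaqSmallOn (plaqsInside (pts k Z)) δ (ext V_k)`, `∀ c ∈ 𝒞, dist1 ((ext V_k) c) ≤ ρn`, (T1@q₀) over the closure of the class ⇒ the (J0′) conclusion verbatim.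
[cite: Balaban1985Variational, (2)–(4),(7) p.278, Thm 1 p.279, (16)–(18) p.280, Sect. C (44)–(48) p.285, (81)–(83) p.290, (181) p.307; Balaban1985RegularSpaces, (1.7), (1.9) p.77, (1.19) p.79; Balaban1989LargeFieldI, (1.74) p.192, Prop. 1 p.194; Balaban1989LargeFieldII, p.357, (1.12)–(1.13) p.359; Balaban1988Convergent, (2.2) p.255, (2.10)–(2.13) pp.256–257, (2.16) p.257; Balaban1985Averaging, Prop. 2 (52)–(54) p.26, (122)–(126) p.36; Balaban1987RG1, (0.4) p.253] -/
theorem hMin_atRecord_Bj_of_printLetters_ofClassDatumLettersUniform (ν : Node00.Stage7Numerics) (Kt : ℕ) (hd3 : 3 ≤ (F.P Kt).d) (Z : Set (Site (F.P Kt) 0))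
    (hkK : k + 1 ≤ (F.P Kt).m + (F.P Kt).K) (hk1 : 1 ≤ k) (hdiv : side (F.P Kt).L ν.M₁ k ∣ (F.P Kt).sitesPerDir 0) (hfloor : ((F.P Kt).d + 14) * (F.P Kt).L ≤ ν.M₁) (hZblk : IsBlockUnion k Z)
    -- the per-HEIGHT letters (EXISTENCE constants per (instance, height), inhabited before everything else by dag-n12-w6's `N12HsurjOfClass.exists_hsurjLetters`): the radius letter `hsbU` at
    -- `ρ″ > 0` and the right-inverse letter `hHB` at `(εH, B)`, `0 ≤ B` — `ν.εreg` is NOT read (the class tolerance `εr` comes after the threshold)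
    {ρ'' : ℝ} (hsbU : ∀ W : GaugeField (F.P Kt) 0 SU2, ‖coeField W - 1‖ ≤ ρ'' → SmallBelow (Node00.avOfRecord F 2 Kt) k W) (hρ : 0 < ρ'')
    {εH B : ℝ}
    (hHB : ∀ (Wd : MSField (F.P Kt) SU2) (U₀ : GaugeField (F.P Kt) 0 SU2),
      AgreeOn (Bj ν.M₁ Z k) (avgFamily (avOfRecord F 2 Kt) U₀) Wd →
      (∀ i' : Fin (constrCard (Bj ν.M₁ Z k) k), ∃ U' : GaugeField (F.P Kt) 0 SU2,
        (∀ b ∈ feeds (((constrEnum (Bj ν.M₁ Z k) k).symm i').1 : ℕ) ((constrEnum (Bj ν.M₁ Z k) k).symm i').2.1, U' b = U₀ b) ∧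
          SmallBelow (avOfRecord F 2 Kt) k U') →
      (∀ (j : ℕ), 1 ≤ j → j ≤ k → ∀ y : Site (F.P Kt) j, embIter j y ∈ maxDomT ν.M₁ Z j → ∃ U' : GaugeField (F.P Kt) 0 SU2,
        (∀ c : PBond (F.P Kt) j, (c.src = y ∨ c.tgt = y) → ∀ b₀ : PBond (F.P Kt) 0,
          (iterBlockOf j b₀.src = c.src ∨ iterBlockOf j b₀.src = c.tgt) → (iterBlockOf j b₀.tgt = c.src ∨ iterBlockOf j b₀.tgt = c.tgt) → U' b₀ = U₀ b₀) ∧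
        SmallBelow (avOfRecord F 2 Kt) k U') →
      (∀ (j : ℕ), 1 ≤ j → j ≤ k → ∀ y : Site (F.P Kt) j, embIter j y ∈ maxDomT ν.M₁ Z j →
        PlaqSmallOn (boxPlaqs (fun κ => lift (F.P Kt) (embIter j y) κ - ((((F.P Kt).L ^ j : ℕ) : ℤ) + ((((F.P Kt).L ^ j - 1) / 2 : ℕ) : ℤ)))
          (fun κ => lift (F.P Kt) (embIter j y) κ + ((((F.P Kt).L ^ j : ℕ) : ℤ) + ((((F.P Kt).L ^ j - 1) / 2 : ℕ) : ℤ))) : Set (Plaq (F.P Kt) 0)) εH U₀) →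
      ∃ H : (Fin (constrCard (Bj ν.M₁ Z k) k) → lieSU (Fin 2)) → PBond (F.P Kt) 0 → lieSU (Fin 2),
        (∀ v, fderiv ℝ (msChart F 2 Kt k (Bj ν.M₁ Z k) Wd U₀) 0 (H v) = v) ∧ ∀ v, Real.sqrt (∑ b, ‖H v b‖ ^ 2) ≤ B * ‖v‖) (hB0 : 0 ≤ B)
    -- (σ)_N OF RECORD (dag-n12-w3's `N12GaugeLetterLocExplicit.exists_gaugeLetterLoc_atRecord_explicit`), instance-level letters VERBATIM:
    -- NUMERICS (i): a level guard `k + c ≤ m + K` with `4d + m′ + 3 < 2·L^c` (no wrapping), and `M₁ ≥ (4d + m′)·L² + 2d·L + 12` (radii), `m′ = 3·(d·((L−1)∕2)) + 5`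
    {c : ℕ} (hkc : k + c ≤ (F.P Kt).m + (F.P Kt).K) (hc : 4 * (F.P Kt).d + (3 * ((F.P Kt).d * (((F.P Kt).L - 1) / 2)) + 5) + 3 < 2 * (F.P Kt).L ^ c)
    (hMrad : (4 * (F.P Kt).d + (3 * ((F.P Kt).d * (((F.P Kt).L - 1) / 2)) + 5)) * (F.P Kt).L ^ 2 + 2 * (F.P Kt).d * (F.P Kt).L + 12 ≤ ν.M₁)
    -- region geometry (dag-n12-w6's letters, verbatim) for a set `𝒞` of scale-`k` bonds and a fine bond set `N`
    (𝒞 : Set (PBond (F.P Kt) k))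
    (N : Set (PBond (F.P Kt) 0))
    (hGN : ∀ b ∈ N, (b.src ∉ maxDomT ν.M₁ Z 1 ∨ b.tgt ∉ maxDomT ν.M₁ Z 1) → blockIter k b.tgt ≠ blockIter k b.src →
      (⟨blockIter k b.src, b.dir⟩ : PBond (F.P Kt) k) ∈ 𝒞)
    (hN1 : ∀ p : Plaq (F.P Kt) 0, ((⟨p.src, p.μ⟩ : PBond (F.P Kt) 0) ∈ {b : PBond (F.P Kt) 0 | b.src ∈ maxDomT ν.M₁ Z 1} ∨
        (⟨p.src.shift p.μ, p.ν⟩ : PBond (F.P Kt) 0) ∈ {b : PBond (F.P Kt) 0 | b.src ∈ maxDomT ν.M₁ Z 1} ∨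
        (⟨p.src.shift p.ν, p.μ⟩ : PBond (F.P Kt) 0) ∈ {b : PBond (F.P Kt) 0 | b.src ∈ maxDomT ν.M₁ Z 1} ∨
        (⟨p.src, p.ν⟩ : PBond (F.P Kt) 0) ∈ {b : PBond (F.P Kt) 0 | b.src ∈ maxDomT ν.M₁ Z 1}) →
      (⟨p.src, p.μ⟩ : PBond (F.P Kt) 0) ∈ N ∧ (⟨p.src.shift p.μ, p.ν⟩ : PBond (F.P Kt) 0) ∈ N ∧
        (⟨p.src.shift p.ν, p.μ⟩ : PBond (F.P Kt) 0) ∈ N ∧ (⟨p.src, p.ν⟩ : PBond (F.P Kt) 0) ∈ N)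
    -- the family's support numerics: `M₁ ≥ ((d+4)L + 6)·L²`
    (hM₁ : (((F.P Kt).d + 4) * (F.P Kt).L + 6) * (F.P Kt).L ^ 2 ≤ ν.M₁)
    -- GEOMETRY instead of the datum letter: the `k`-shadows of the face-crossing members of `𝐁_k(Z)` lie in `𝒞`
    (hGmem : ∀ i ≤ k, ∀ c ∈ bondsOf ((Bj ν.M₁ Z k : DetSet (F.P Kt)) i), blockIter k (embIter i c.tgt) ≠ blockIter k (embIter i c.src) →
      (⟨blockIter k (embIter i c.src), c.dir⟩ : PBond (F.P Kt) k) ∈ 𝒞) :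
    ∃ δ₀ : ℝ, 0 < δ₀ ∧
    -- THE WINDOW, THE DATUM's REGULARITY TOLERANCE, THE EXTENSION, THE COMPACT PARAMETER SET AND THE BOUND — ALL AFTER THE CONSTANTS
    ∀ (Λ : Set (Site (F.P Kt) k)) (lo hi : Fin (F.P Kt).d → ℤ) {δ : ℝ}, 0 < δ → 6 * ((((F.P Kt).d - 1 : ℕ)) : ℝ) * (F.P Kt).L ^ k * δ ≤ ρ'' →
    ∀ (ext : GaugeField (F.P Kt) k SU2 → GaugeField (F.P Kt) k SU2), (∀ W, ext W = extend Λ (shellGauge W lo hi) W) →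
    ∀ {K : Set (GaugeField (F.P Kt) k SU2)}, IsCompact K → ∀ {𝓐₀ : ℝ}, 1 < 𝓐₀ →
    -- THE CLASS TOLERANCE (positive, [4]-Prop.-2-small, below the floors), THE CLASS FACTS, THE DATUM TOLERANCE — ALL AFTER THE THRESHOLD (`ν⟨εreg := εr⟩`, `M₁` unchanged)
    -- (w1 g4's class letters at the tolerance `εr`: positivity and [4] Prop. 2's smallness at `α₀ = 2L²·εr` — the inputs of `classLetters_closure_regMSCoPOfRecord_Bj`, which discharges U3's
    -- class facts `reg' hreg' hcl hDreg'` at `reg' := closure` of `U_k({Ω_j(Z)}, εr)`; U3's own (σ)_N class numerics `hα3`∕`hα2`∕`haN` at `α₀ = εr·L²` follow from them and are discharged)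
    ∀ (εr : ℝ), 0 < εr → 12 * ((((F.P Kt).d - 1 : ℕ)) : ℝ) * (F.P Kt).L * εr ≤ ρ'' → εr ≤ εH →
      (143 * (((((F.P Kt).d + 4 : ℕ) : ℝ)) ^ 2 / 4) ^ 2) * (2 * ((F.P Kt).L : ℝ) ^ 2 * εr) ≤ 1 / 3 →
      2 * (2 * ((F.P Kt).L : ℝ) ^ 2 * εr) ≤ 2 * deltaSU (Fin 2) / ((((F.P Kt).d + 4) * (F.P Kt).L : ℕ) : ℝ) ^ 2 →
    ∀ {ρn : ℝ}, 0 ≤ ρn →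
    ((max ρn ((((2 * (∑ i ∈ Finset.range (k + 1), ((F.P Kt).d * (((F.P Kt).L ^ i - 1) / 2) + 1)) + 1 +
                  (3 * ((F.P Kt).d * (((F.P Kt).L - 1) / 2)) + 5) * (F.P Kt).L ^ k : ℕ) : ℝ)) ^ 2 / 4 * (εr * (F.P Kt).eta 0 ^ 2) +
                ((3 * ((F.P Kt).d * (((F.P Kt).L - 1) / 2)) + 5 : ℕ) : ℝ) * (6 * ((((((F.P Kt).d + 2) * (F.P Kt).L : ℕ) : ℝ) ^ 2 / 4) * (2 * (εr * (F.P Kt).L ^ 2))) * ∑ i ∈ Finset.range k, ((F.P Kt).L : ℝ) ^ i) + ((3 * ((F.P Kt).d * (((F.P Kt).L - 1) / 2)) + 5 : ℕ) : ℝ) * ρn) ≤ δ₀) →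
    (∀ Vk ∈ K, ∃ U₀ : GaugeField (F.P Kt) 0 SU2,
      IsMinimizer (Node00.avOfRecord F 2 Kt) (Node00.regMSCoPOfRecord F 2 {ν with εreg := εr} Kt k (maxDomT ν.M₁ Z)) (Bj ν.M₁ Z k)
        (avgFamily (Node00.avOfRecord F 2 Kt) (qsstarGIter0 k (ext Vk))) U₀ ∧
      -- the DATUM's scale-`k` plaquette regularity on `Z` (the p. 193 extension `Ṽ_k = ext V_k`; the road's `B15ShellGauge193Local.dist1_plaqHol_extend_shellGauge_le`)
      PlaqSmallOn (plaqsInside (pts k Z)) δ (ext Vk) ∧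
      -- THE DATUM LETTER (region-normalised datum): `ext V_k` is `ρn`-flat on `𝒞`
      (∀ c ∈ 𝒞, dist1 ((ext Vk) c) ≤ ρn) ∧
      -- (T1@q₀) — the capstone's row verbatim
      (∀ U ∈ closure (Node00.regMSCoPOfRecord F 2 {ν with εreg := εr} Kt k (maxDomT ν.M₁ Z)),
        AgreeOn (Bj ν.M₁ Z k) (avgFamily (Node00.avOfRecord F 2 Kt) U) (avgFamily (Node00.avOfRecord F 2 Kt) (qsstarGIter0 k (ext Vk))) →
        wilsonAction4 U ≤ wilsonAction4 U₀ →
          ∃ u : GaugeTransf (F.P Kt) 0 SU2, (∀ j, j ≤ k → ∀ b ∈ bondsOf (Bj ν.M₁ Z k j), toMS u j b.src = toMS u j b.tgt ∧ ∀ g : SU2, toMS u j b.src * g = g * toMS u j b.src) ∧ gaugeAct u U = U₀)) →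
    ∃ R : ℝ, 0 < R ∧ ∀ Vk ∈ K,
      ∃ Ũ : VecField (F.P Kt) k (EuclideanSpace ℂ (Fin 3)) × VecField (F.P Kt) k (EuclideanSpace ℂ (Fin 3)) → PBond (F.P Kt) 0 → Matrix (Fin 2) (Fin 2) ℂ,
        (∀ b i j, DifferentiableOn ℂ (fun z => Ũ z b i j) (ball 0 R)) ∧
        (∀ z ∈ ball (0 : VecField (F.P Kt) k (EuclideanSpace ℂ (Fin 3)) × VecField (F.P Kt) k (EuclideanSpace ℂ (Fin 3))) R, ∀ b i j, ‖Ũ z b i j‖ ≤ 𝓐₀) ∧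
        ∀ p B' : VecField (F.P Kt) k E3, ‖p‖ < R → ‖B'‖ < R → ∃ U' : GaugeField (F.P Kt) 0 SU2,
          (∀ b, Ũ (cplxVec p, cplxVec B') b = ((U' b : SU2) : Matrix (Fin 2) (Fin 2) ℂ)) ∧
            IsMinimizer (Node00.avOfRecord F 2 Kt) (Node00.regMSCoPOfRecord F 2 {ν with εreg := εr} Kt k (maxDomT ν.M₁ Z)) (Bj ν.M₁ Z k)
              (avgFamily (Node00.avOfRecord F 2 Kt) (qsstarGIter0 k (expMul su2Chart B' (ext (expMul su2Chart p Vk))))) U') := by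
  have hk : k ≤ (F.P Kt).m + (F.P Kt).K := Nat.le_of_succ_le hkK
  have hM4 : 4 * (F.P Kt).L ≤ ν.M₁ := le_trans (Nat.mul_le_mul_right _ (by omega)) hfloor
  have hM : 1 ≤ ν.M₁ := le_trans (Nat.succ_le_of_lt (Nat.mul_pos (Nat.succ_pos _) (F.P Kt).L_pos)) hfloor
  have hd2 : 2 ≤ (F.P Kt).d := le_trans (by norm_num) hd3
  -- ONE forest with its axial slice (dag-n12-w3), BEFORE the threshold
  obtain ⟨path, S, hF1, hF2, hTREE, hF3, -⟩ := exists_forest_slice_Bj (P := F.P Kt) (M₁ := ν.M₁) (Z := Z) hk hk1 hM hdiv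
  obtain ⟨δ₀, hδ₀, h⟩ := hMin_atRecord_of_node00Letters_thm1AtBase_central_ofClass_datumLetters_uniform ν Kt hd2 Z (Bj ν.M₁ Z k) rfl hkK hM4 hdiv hZblk hsbU hρ hk1 hHB hB0 path S hF1 hF2 hTREE hF3
    hkc hc hMrad 𝒞 N hGN hN1 hM₁ hGmem
  refine ⟨δ₀, hδ₀, ?_⟩
  intro Λ lo hi δ hδ hδρ ext hext K hK 𝓐₀ h𝓐₀ εr hεr hερ hεH hα3 hα2 ρn hρn hT hbase
  -- U3's (σ)_N class numerics at `α₀ = εr·L²` from the class letters at `α₀ = 2L²·εr`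
  have hL : (0 : ℝ) < ((F.P Kt).L : ℝ) := by exact_mod_cast (F.P Kt).L_pos
  have hEL : 0 ≤ εr * ((F.P Kt).L : ℝ) ^ 2 := by positivity
  have hE2 : εr * ((F.P Kt).L : ℝ) ^ 2 ≤ 2 * ((F.P Kt).L : ℝ) ^ 2 * εr := by nlinarith [hEL]
  have hα3' : (143 * (((((F.P Kt).d + 4 : ℕ) : ℝ)) ^ 2 / 4) ^ 2) * (εr * (F.P Kt).L ^ 2) ≤ 1 / 3 :=
    le_trans (mul_le_mul_of_nonneg_left hE2 (by positivity)) hα3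
  have hα2' : 2 * (εr * (F.P Kt).L ^ 2) ≤ 2 * deltaSU (Fin 2) / ((((F.P Kt).d + 4) * (F.P Kt).L : ℕ) : ℝ) ^ 2 := le_trans (by linarith) hα2
  have haN : (((((F.P Kt).d + 2) * (F.P Kt).L : ℕ) : ℝ) ^ 2 / 4) * (2 * (εr * (F.P Kt).L ^ 2)) < deltaSU (Fin 2) := by
    have h24 : ((((F.P Kt).d + 2) * (F.P Kt).L : ℕ) : ℝ) ≤ ((((F.P Kt).d + 4) * (F.P Kt).L : ℕ) : ℝ) := by
      exact_mod_cast Nat.mul_le_mul_right _ (by omega)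
    have hsq : ((((F.P Kt).d + 2) * (F.P Kt).L : ℕ) : ℝ) ^ 2 ≤ ((((F.P Kt).d + 4) * (F.P Kt).L : ℕ) : ℝ) ^ 2 := by gcongr
    have hδS : 0 < deltaSU (Fin 2) := deltaSU_pos
    have hD4 : (0 : ℝ) < ((((F.P Kt).d + 4) * (F.P Kt).L : ℕ) : ℝ) := by exact_mod_cast Nat.mul_pos (by omega) (F.P Kt).L_pos
    have h1 : 2 * (2 * ((F.P Kt).L : ℝ) ^ 2 * εr) * ((((F.P Kt).d + 4) * (F.P Kt).L : ℕ) : ℝ) ^ 2 ≤ 2 * deltaSU (Fin 2) :=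
      (le_div_iff₀ (by positivity)).1 hα2
    have h2 : εr * (F.P Kt).L ^ 2 * ((((F.P Kt).d + 4) * (F.P Kt).L : ℕ) : ℝ) ^ 2 ≤ deltaSU (Fin 2) / 2 := by nlinarith [h1]
    have h3 : εr * (F.P Kt).L ^ 2 * ((((F.P Kt).d + 2) * (F.P Kt).L : ℕ) : ℝ) ^ 2 ≤ deltaSU (Fin 2) / 2 :=
      le_trans (mul_le_mul_of_nonneg_left hsq hEL) h2
    nlinarith [h3, hδS]
  -- the class facts (dag-n12-w1 g4) at the tolerance `εr`
  obtain ⟨hreg', hcl, hDreg'⟩ :=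
    classLetters_closure_regMSCoPOfRecord_Bj (F := F) (N := 2) (K := Kt) {ν with εreg := εr} hεr hk hdiv hfloor Z k (Nat.le_succ k) hα3 hα2
  exact h Λ lo hi hδ hδρ ext hext hK h𝓐₀ εr hεr hερ hεH hα3' hα2' haN (closure (Node00.regMSCoPOfRecord F 2 {ν with εreg := εr} Kt k (maxDomT ν.M₁ Z))) hreg' hcl hDreg' hρn hT hbase


/-! ## §2  §1 on the (compact) CLOSED small-field guard — the shape the knit-row junction consumes -/

/-- ★★★ **§1 ON THE CLOSED GUARD `{∀ p ∈ G, |V_k(∂p) − 1| ≤ eR}` (any `G`, any `eR`, in `K`'s place after `δ₀`)**: the guard is compact (`isCompact_setOf_plaqLeOn`), so §1 at `K :=` the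
guard gives ONE radius `R` for every guarded base field — the shape `N12MinimiserFamilyKnitRowThresholdUniform` §3 consumes at `G := plaqsInside (pts k (Z ∩ Λᶜ))`.
[cite: Balaban1989LargeFieldI, (1.74) p.192, Prop. 1 p.194 (last clause); Balaban1985Variational, Thm 1 p.279, (7) p.278, (181) p.307, Prop. 9 (190) p.309; Balaban1988Convergent, (2.12)–(2.13) pp.256–257] -/
theorem hMin_closedGuard_atRecord_Bj_of_printLetters_ofClassDatumLettersUniform (ν : Node00.Stage7Numerics) (Kt : ℕ) (hd3 : 3 ≤ (F.P Kt).d) (Z : Set (Site (F.P Kt) 0))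
    (hkK : k + 1 ≤ (F.P Kt).m + (F.P Kt).K) (hk1 : 1 ≤ k) (hdiv : side (F.P Kt).L ν.M₁ k ∣ (F.P Kt).sitesPerDir 0) (hfloor : ((F.P Kt).d + 14) * (F.P Kt).L ≤ ν.M₁) (hZblk : IsBlockUnion k Z)
    -- the per-HEIGHT letters (EXISTENCE constants per (instance, height), inhabited before everything else by dag-n12-w6's `N12HsurjOfClass.exists_hsurjLetters`): the radius letter `hsbU` at
    -- `ρ″ > 0` and the right-inverse letter `hHB` at `(εH, B)`, `0 ≤ B` — `ν.εreg` is NOT read (the class tolerance `εr` comes after the threshold)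
    {ρ'' : ℝ} (hsbU : ∀ W : GaugeField (F.P Kt) 0 SU2, ‖coeField W - 1‖ ≤ ρ'' → SmallBelow (Node00.avOfRecord F 2 Kt) k W) (hρ : 0 < ρ'')
    {εH B : ℝ}
    (hHB : ∀ (Wd : MSField (F.P Kt) SU2) (U₀ : GaugeField (F.P Kt) 0 SU2),
      AgreeOn (Bj ν.M₁ Z k) (avgFamily (avOfRecord F 2 Kt) U₀) Wd →
      (∀ i' : Fin (constrCard (Bj ν.M₁ Z k) k), ∃ U' : GaugeField (F.P Kt) 0 SU2,
        (∀ b ∈ feeds (((constrEnum (Bj ν.M₁ Z k) k).symm i').1 : ℕ) ((constrEnum (Bj ν.M₁ Z k) k).symm i').2.1, U' b = U₀ b) ∧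
          SmallBelow (avOfRecord F 2 Kt) k U') →
      (∀ (j : ℕ), 1 ≤ j → j ≤ k → ∀ y : Site (F.P Kt) j, embIter j y ∈ maxDomT ν.M₁ Z j → ∃ U' : GaugeField (F.P Kt) 0 SU2,
        (∀ c : PBond (F.P Kt) j, (c.src = y ∨ c.tgt = y) → ∀ b₀ : PBond (F.P Kt) 0,
          (iterBlockOf j b₀.src = c.src ∨ iterBlockOf j b₀.src = c.tgt) → (iterBlockOf j b₀.tgt = c.src ∨ iterBlockOf j b₀.tgt = c.tgt) → U' b₀ = U₀ b₀) ∧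
        SmallBelow (avOfRecord F 2 Kt) k U') →
      (∀ (j : ℕ), 1 ≤ j → j ≤ k → ∀ y : Site (F.P Kt) j, embIter j y ∈ maxDomT ν.M₁ Z j →
        PlaqSmallOn (boxPlaqs (fun κ => lift (F.P Kt) (embIter j y) κ - ((((F.P Kt).L ^ j : ℕ) : ℤ) + ((((F.P Kt).L ^ j - 1) / 2 : ℕ) : ℤ)))
          (fun κ => lift (F.P Kt) (embIter j y) κ + ((((F.P Kt).L ^ j : ℕ) : ℤ) + ((((F.P Kt).L ^ j - 1) / 2 : ℕ) : ℤ))) : Set (Plaq (F.P Kt) 0)) εH U₀) →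
      ∃ H : (Fin (constrCard (Bj ν.M₁ Z k) k) → lieSU (Fin 2)) → PBond (F.P Kt) 0 → lieSU (Fin 2),
        (∀ v, fderiv ℝ (msChart F 2 Kt k (Bj ν.M₁ Z k) Wd U₀) 0 (H v) = v) ∧ ∀ v, Real.sqrt (∑ b, ‖H v b‖ ^ 2) ≤ B * ‖v‖) (hB0 : 0 ≤ B)
    -- (σ)_N OF RECORD (dag-n12-w3's `N12GaugeLetterLocExplicit.exists_gaugeLetterLoc_atRecord_explicit`), instance-level letters VERBATIM:
    -- NUMERICS (i): a level guard `k + c ≤ m + K` with `4d + m′ + 3 < 2·L^c` (no wrapping), and `M₁ ≥ (4d + m′)·L² + 2d·L + 12` (radii), `m′ = 3·(d·((L−1)∕2)) + 5`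
    {c : ℕ} (hkc : k + c ≤ (F.P Kt).m + (F.P Kt).K) (hc : 4 * (F.P Kt).d + (3 * ((F.P Kt).d * (((F.P Kt).L - 1) / 2)) + 5) + 3 < 2 * (F.P Kt).L ^ c)
    (hMrad : (4 * (F.P Kt).d + (3 * ((F.P Kt).d * (((F.P Kt).L - 1) / 2)) + 5)) * (F.P Kt).L ^ 2 + 2 * (F.P Kt).d * (F.P Kt).L + 12 ≤ ν.M₁)
    -- region geometry (dag-n12-w6's letters, verbatim) for a set `𝒞` of scale-`k` bonds and a fine bond set `N`
    (𝒞 : Set (PBond (F.P Kt) k))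
    (N : Set (PBond (F.P Kt) 0))
    (hGN : ∀ b ∈ N, (b.src ∉ maxDomT ν.M₁ Z 1 ∨ b.tgt ∉ maxDomT ν.M₁ Z 1) → blockIter k b.tgt ≠ blockIter k b.src →
      (⟨blockIter k b.src, b.dir⟩ : PBond (F.P Kt) k) ∈ 𝒞)
    (hN1 : ∀ p : Plaq (F.P Kt) 0, ((⟨p.src, p.μ⟩ : PBond (F.P Kt) 0) ∈ {b : PBond (F.P Kt) 0 | b.src ∈ maxDomT ν.M₁ Z 1} ∨
        (⟨p.src.shift p.μ, p.ν⟩ : PBond (F.P Kt) 0) ∈ {b : PBond (F.P Kt) 0 | b.src ∈ maxDomT ν.M₁ Z 1} ∨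
        (⟨p.src.shift p.ν, p.μ⟩ : PBond (F.P Kt) 0) ∈ {b : PBond (F.P Kt) 0 | b.src ∈ maxDomT ν.M₁ Z 1} ∨
        (⟨p.src, p.ν⟩ : PBond (F.P Kt) 0) ∈ {b : PBond (F.P Kt) 0 | b.src ∈ maxDomT ν.M₁ Z 1}) →
      (⟨p.src, p.μ⟩ : PBond (F.P Kt) 0) ∈ N ∧ (⟨p.src.shift p.μ, p.ν⟩ : PBond (F.P Kt) 0) ∈ N ∧
        (⟨p.src.shift p.ν, p.μ⟩ : PBond (F.P Kt) 0) ∈ N ∧ (⟨p.src, p.ν⟩ : PBond (F.P Kt) 0) ∈ N)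
    -- the family's support numerics: `M₁ ≥ ((d+4)L + 6)·L²`
    (hM₁ : (((F.P Kt).d + 4) * (F.P Kt).L + 6) * (F.P Kt).L ^ 2 ≤ ν.M₁)
    -- GEOMETRY instead of the datum letter: the `k`-shadows of the face-crossing members of `𝐁_k(Z)` lie in `𝒞`
    (hGmem : ∀ i ≤ k, ∀ c ∈ bondsOf ((Bj ν.M₁ Z k : DetSet (F.P Kt)) i), blockIter k (embIter i c.tgt) ≠ blockIter k (embIter i c.src) →
      (⟨blockIter k (embIter i c.src), c.dir⟩ : PBond (F.P Kt) k) ∈ 𝒞) :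
    ∃ δ₀ : ℝ, 0 < δ₀ ∧
    -- THE WINDOW, THE DATUM's REGULARITY TOLERANCE, THE EXTENSION, THE COMPACT PARAMETER SET AND THE BOUND — ALL AFTER THE CONSTANTS
    ∀ (Λ : Set (Site (F.P Kt) k)) (lo hi : Fin (F.P Kt).d → ℤ) {δ : ℝ}, 0 < δ → 6 * ((((F.P Kt).d - 1 : ℕ)) : ℝ) * (F.P Kt).L ^ k * δ ≤ ρ'' →
    ∀ (ext : GaugeField (F.P Kt) k SU2 → GaugeField (F.P Kt) k SU2), (∀ W, ext W = extend Λ (shellGauge W lo hi) W) →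
    ∀ (G : Set (Plaq (F.P Kt) k)) (eR : ℝ) {𝓐₀ : ℝ}, 1 < 𝓐₀ →
    -- THE CLASS TOLERANCE (positive, [4]-Prop.-2-small, below the floors), THE CLASS FACTS, THE DATUM TOLERANCE — ALL AFTER THE THRESHOLD (`ν⟨εreg := εr⟩`, `M₁` unchanged)
    -- (w1 g4's class letters at the tolerance `εr`: positivity and [4] Prop. 2's smallness at `α₀ = 2L²·εr` — the inputs of `classLetters_closure_regMSCoPOfRecord_Bj`, which discharges U3's
    -- class facts `reg' hreg' hcl hDreg'` at `reg' := closure` of `U_k({Ω_j(Z)}, εr)`; U3's own (σ)_N class numerics `hα3`∕`hα2`∕`haN` at `α₀ = εr·L²` follow from them and are discharged)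
    ∀ (εr : ℝ), 0 < εr → 12 * ((((F.P Kt).d - 1 : ℕ)) : ℝ) * (F.P Kt).L * εr ≤ ρ'' → εr ≤ εH →
      (143 * (((((F.P Kt).d + 4 : ℕ) : ℝ)) ^ 2 / 4) ^ 2) * (2 * ((F.P Kt).L : ℝ) ^ 2 * εr) ≤ 1 / 3 →
      2 * (2 * ((F.P Kt).L : ℝ) ^ 2 * εr) ≤ 2 * deltaSU (Fin 2) / ((((F.P Kt).d + 4) * (F.P Kt).L : ℕ) : ℝ) ^ 2 →
    ∀ {ρn : ℝ}, 0 ≤ ρn →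
    ((max ρn ((((2 * (∑ i ∈ Finset.range (k + 1), ((F.P Kt).d * (((F.P Kt).L ^ i - 1) / 2) + 1)) + 1 +
                  (3 * ((F.P Kt).d * (((F.P Kt).L - 1) / 2)) + 5) * (F.P Kt).L ^ k : ℕ) : ℝ)) ^ 2 / 4 * (εr * (F.P Kt).eta 0 ^ 2) +
                ((3 * ((F.P Kt).d * (((F.P Kt).L - 1) / 2)) + 5 : ℕ) : ℝ) * (6 * ((((((F.P Kt).d + 2) * (F.P Kt).L : ℕ) : ℝ) ^ 2 / 4) * (2 * (εr * (F.P Kt).L ^ 2))) * ∑ i ∈ Finset.range k, ((F.P Kt).L : ℝ) ^ i) + ((3 * ((F.P Kt).d * (((F.P Kt).L - 1) / 2)) + 5 : ℕ) : ℝ) * ρn) ≤ δ₀) →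
    (∀ Vk : GaugeField (F.P Kt) k SU2, (∀ p ∈ G, dist1 (GaugeField.plaqHol Vk p) ≤ eR) → ∃ U₀ : GaugeField (F.P Kt) 0 SU2,
      IsMinimizer (Node00.avOfRecord F 2 Kt) (Node00.regMSCoPOfRecord F 2 {ν with εreg := εr} Kt k (maxDomT ν.M₁ Z)) (Bj ν.M₁ Z k)
        (avgFamily (Node00.avOfRecord F 2 Kt) (qsstarGIter0 k (ext Vk))) U₀ ∧
      -- the DATUM's scale-`k` plaquette regularity on `Z` (the p. 193 extension `Ṽ_k = ext V_k`; the road's `B15ShellGauge193Local.dist1_plaqHol_extend_shellGauge_le`)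
      PlaqSmallOn (plaqsInside (pts k Z)) δ (ext Vk) ∧
      -- THE DATUM LETTER (region-normalised datum): `ext V_k` is `ρn`-flat on `𝒞`
      (∀ c ∈ 𝒞, dist1 ((ext Vk) c) ≤ ρn) ∧
      -- (T1@q₀) — the capstone's row verbatim
      (∀ U ∈ closure (Node00.regMSCoPOfRecord F 2 {ν with εreg := εr} Kt k (maxDomT ν.M₁ Z)),
        AgreeOn (Bj ν.M₁ Z k) (avgFamily (Node00.avOfRecord F 2 Kt) U) (avgFamily (Node00.avOfRecord F 2 Kt) (qsstarGIter0 k (ext Vk))) →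
        wilsonAction4 U ≤ wilsonAction4 U₀ →
          ∃ u : GaugeTransf (F.P Kt) 0 SU2, (∀ j, j ≤ k → ∀ b ∈ bondsOf (Bj ν.M₁ Z k j), toMS u j b.src = toMS u j b.tgt ∧ ∀ g : SU2, toMS u j b.src * g = g * toMS u j b.src) ∧ gaugeAct u U = U₀)) →
    ∃ R : ℝ, 0 < R ∧ ∀ Vk : GaugeField (F.P Kt) k SU2, (∀ p ∈ G, dist1 (GaugeField.plaqHol Vk p) ≤ eR) →
      ∃ Ũ : VecField (F.P Kt) k (EuclideanSpace ℂ (Fin 3)) × VecField (F.P Kt) k (EuclideanSpace ℂ (Fin 3)) → PBond (F.P Kt) 0 → Matrix (Fin 2) (Fin 2) ℂ,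
        (∀ b i j, DifferentiableOn ℂ (fun z => Ũ z b i j) (ball 0 R)) ∧
        (∀ z ∈ ball (0 : VecField (F.P Kt) k (EuclideanSpace ℂ (Fin 3)) × VecField (F.P Kt) k (EuclideanSpace ℂ (Fin 3))) R, ∀ b i j, ‖Ũ z b i j‖ ≤ 𝓐₀) ∧
        ∀ p B' : VecField (F.P Kt) k E3, ‖p‖ < R → ‖B'‖ < R → ∃ U' : GaugeField (F.P Kt) 0 SU2,
          (∀ b, Ũ (cplxVec p, cplxVec B') b = ((U' b : SU2) : Matrix (Fin 2) (Fin 2) ℂ)) ∧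
            IsMinimizer (Node00.avOfRecord F 2 Kt) (Node00.regMSCoPOfRecord F 2 {ν with εreg := εr} Kt k (maxDomT ν.M₁ Z)) (Bj ν.M₁ Z k)
              (avgFamily (Node00.avOfRecord F 2 Kt) (qsstarGIter0 k (expMul su2Chart B' (ext (expMul su2Chart p Vk))))) U') := by
  obtain ⟨δ₀, hδ₀, h⟩ := hMin_atRecord_Bj_of_printLetters_ofClassDatumLettersUniform ν Kt hd3 Z hkK hk1 hdiv hfloor hZblk hsbU hρ hHB hB0 hkc hc hMrad 𝒞 N hGN hN1 hM₁ hGmem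
  refine ⟨δ₀, hδ₀, ?_⟩
  intro Λ lo hi δ hδ hδρ ext hext G eR 𝓐₀ h𝓐₀ εr hεr hερ hεH hα3 hα2 ρn hρn hT hletters
  exact h Λ lo hi hδ hδρ ext hext (isCompact_setOf_plaqLeOn G eR) h𝓐₀ εr hεr hερ hεH hα3 hα2 hρn hT hletters

end Summit.QuantumFields.YangMills.BalabanUVNodes.N12MinimiserFamilyAtRecordBjTowerDatumLettersUniform

end
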